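import Literature.AlgebraicGeometry.HodgeTheory.SemiregularityHigherSigma
import Literature.AlgebraicGeometry.HodgeTheory.ChernCharacterBetti
import Literature.AlgebraicGeometry.Modules.PushforwardClosedImmersionExact
import Literature.AlgebraicGeometry.Modules.LinearOverBase
import Literature.AlgebraicGeometry.Motives.AbelianVariety
import Mathlib.Algebra.Homology.DerivedCategory.Ext.Map
import Mathlib.Algebra.Homology.DerivedCategory.Ext.Linear
import HarnessLib

/-!
# Involution-equivariant semiregularity: carriers (`μ₂`-linearisations, the induced action on `Ext`,
# invariant `I`-semiregularity, the `B`-twisted Chern character)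

Family `hodge`, layer `Literature/AlgebraicGeometry/HodgeTheory`. DEFINITIONS ONLY (no named fact, no
conjecture): the vocabulary in which an EQUIVARIANT form of the semiregularity theorem
(Buchweitz–Flenner 2003, Thm. 5.1; Perry 2026, Thm. 1.1 / Thm. 6.3) is STATED for a scheme `X` carrying an
involution `ι` (`ι ≫ ι = 𝟙`; the case every consumer has in mind is the inversion `[-1]` of an abelian
scheme, `abelianNegOne`):

* `pushforwardInvolutionIso ι hι : ι_* ⋙ ι_* ≅ 𝟭` — for an involution, `ι_* ι_* = (ι ≫ ι)_* = 𝟙_*`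
  (Mathlib's pseudofunctor isomorphisms `pushforwardComp`, `pushforwardCongr`, `pushforwardId`);
* `IsInvolutionLinearisation ι hι lam` — an isomorphism `lam : M ≅ ι_* M` is a `μ₂`-LINEARISATION
  (a `⟨ι⟩ ≅ ℤ/2`-equivariant structure on `M`): `ι_*(lam) ∘ lam` is the canonical `M ≅ ι_* ι_* M`
  (Mumford–Fogarty–Kirwan, GIT Ch. 1 §3, Def. 1.6: a `G`-linearisation is an isomorphism
  `σ^*L ≅ p₂^*L` satisfying the cocycle condition; for `G = μ₂ = {1, ι}` and `ι^* = ι_*` this is one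
  isomorphism and one identity);
* `extInvolutionAct ι hι lam n : Extⁿ(F,F) → Extⁿ(F,F)`, `x ↦ lam⁻¹ ∘ ι_*(x) ∘ lam` — the action of `ι` on
  the self-extensions of a linearised `F` (`ι_*` is exact, being an isomorphism, so it acts on Mathlib's
  `Abelian.Ext` through `Ext.mapExactFunctor`; conjugation by `lam` through `Ext.mk₀` and `Ext.comp`). This is
  the action under which Perry's equivariant theory takes INVARIANTS ("`Ext²(E,E)^G`", Perry 2026 §6, Thm. 6.3,
  for `G` acting on the category; Markman 2025 §8.3: "`Ext²(F,F)^G`", Lemma 8.3.4);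
* `extInvariants ι hι lam n` — the `ι`-INVARIANT part: the submodule (over the base ring) spanned by the fixed
  classes (equal to the fixed set, the action being linear);
* `IsInvariantISemiregular ι hι lam hE I` — the part `(σ_q)_{q ∈ I}` of the Buchweitz–Flenner semiregularity
  map (`SemiregularityHigherSigma.sigmaHigher`) is injective ON THE INVARIANT PART of `Ext²(E,E)`
  (BF §5 "`I`-semiregular" restricted to invariants; for `I = univ` this is the hypothesis of the
  equivariant semiregularity theorem, Perry Thm. 6.3: "`σ` injective on `Ext²(E,E)^G`"). It is implied by
  plain `IsISemiregular hE I` (`IsISemiregular.isInvariantISemiregular`, PROVED);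
* `expTwistCh C X B E k = (exp(B) ∪ ch(E))_k = Σ_{i+j=k} (1/i!) Bⁱ ∪ ch_j(E)` — the degree-`2k` component of
  the `B`-twisted Chern character of `E` for a class `B ∈ H²(X(ℂ); ℂ)` (Huybrechts–Stellari 2005, §1:
  `ch^B(E) = ch(E) · exp(B)`; Perry 2026, Thm. 1.1: "`w_0 = exp(B_0) · ch(E_0)`"), in a Chern character theory
  `C : ChernCharacterBetti` on the tree's real carrier `complexBetti`, with `cupPowTwo` and `cupProduct`;
* `abelianNegOne Y = [-1]_Y` on the underlying scheme of an abelian variety and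
  `abelianNegOne_comp_abelianNegOne : [-1] ≫ [-1] = 𝟙` (PROVED; Mumford §4: `i_X ∘ i_X = id`).

What is deliberately NOT here: any assertion that the equivariant semiregularity theorem HOLDS (Perry's Thm. 6.3
assumes a free action, Lemma 5.18 / Rem. 6.4; for an involution with fixed points the statement is a CONJECTURE and
lives summit-side as a route item, D-0014 / planner rule 4b), the perfect-complex generality of Perry's `E_0`
(the tree's `sigmaHigher` needs `E` finite locally free), and GRR for `ι_*`.

## References

* [BuchweitzFlenner2003] R.-O. Buchweitz, H. Flenner, *A semiregularity map for modules and applications to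
  deformations*, Compositio Math. 137 (2003), Def. 4.1, §5 (`I`-semiregular), Thm. 5.1.
* [Perry2026Semiregularity] A. Perry, *The semiregularity theorem for equivariant noncommutative varieties*,
  arXiv:2604.00511 (2026), Thm. 1.1, Def. 2.4, Rem. 2.5, Lemma 5.18, Thm. 6.3, Rem. 6.4.
* [MumfordFogartyKirwan1994] D. Mumford, J. Fogarty, F. Kirwan, *Geometric Invariant Theory*, 3rd ed., Ch. 1 §3,
  Def. 1.6 (linearisation).
* [HuybrechtsStellari2005] D. Huybrechts, P. Stellari, *Equivalences of twisted K3 surfaces*, Math. Ann. 332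
  (2005), §1 (twisted Chern character `ch^B`).
* [Markman2025SecantWeil] E. Markman, *Cycles on abelian 2n-folds of Weil type from secant sheaves on abelian
  n-folds*, arXiv:2502.03415, §8.3 (Lemma 8.3.4: `Ext²(F,F)^G`).
* [MumfordAV1970] D. Mumford, *Abelian Varieties* (1970), §4 (the inverse morphism).
-/

noncomputable section

open CategoryTheory CategoryTheory.Abelian CategoryTheory.Limits AlgebraicGeometry

namespace Literature.AlgebraicGeometry.HodgeTheory

open Literature.AlgebraicTopology.SingularHomology Literature.AlgebraicGeometry.Motives
  Literature.AlgebraicGeometry.Modules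

universe w u

/-! ### Involutions and `μ₂`-linearisations -/

section Involution

variable {X : Scheme.{u}} (ι : X ⟶ X) (hι : ι ≫ ι = 𝟙 X)

/-- An involution of a scheme is an isomorphism (it is its own inverse). [folklore] -/
theorem isIso_of_comp_self_eq_id {X : Scheme.{u}} (ι : X ⟶ X) (hι : ι ≫ ι = 𝟙 X) : IsIso ι :=
  ⟨ι, hι, hι⟩

/-- **`ι_* ι_* ≅ 𝟭` for an involution `ι`**: `ι_* ⋙ ι_* ≅ (ι ≫ ι)_* = (𝟙_X)_* ≅ 𝟭` (Mathlib's pseudofunctor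
isomorphisms of `Scheme.Modules.pushforward`). [folklore] -/
def pushforwardInvolutionIso :
    Scheme.Modules.pushforward ι ⋙ Scheme.Modules.pushforward ι ≅ 𝟭 X.Modules :=
  Scheme.Modules.pushforwardComp ι ι ≪≫ Scheme.Modules.pushforwardCongr hι ≪≫
    Scheme.Modules.pushforwardId X

/-- **A `μ₂`-linearisation of the `𝒪_X`-module `M` along the involution `ι`**: an isomorphism
`lam : M ≅ ι_* M` satisfying the cocycle condition `ι_*(lam) ∘ lam = (M ≅ ι_* ι_* M)` — a
`G`-linearisation in the sense of GIT, Ch. 1 §3, Def. 1.6 ("an isomorphism `φ : σ^*L → p₂^*L`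
[…] satisfying the cocycle condition") for the group `G = {1, ι} ≅ ℤ/2` (one isomorphism, one identity;
`ι^* = ι_*` for an involution). [cite: MumfordFogartyKirwan1994, Ch. 1 §3 Def. 1.6] -/
def IsInvolutionLinearisation {M : X.Modules} (lam : M ≅ (Scheme.Modules.pushforward ι).obj M) : Prop :=
  lam.hom ≫ (Scheme.Modules.pushforward ι).map lam.hom = (pushforwardInvolutionIso ι hι).inv.app M

end Involution

/-! ### The action of an involution on `Extⁿ(F, F)` and the invariant part -/

section ExtAction

variable {S : Type u} [CommRing S] {X : Over (Spec (CommRingCat.of S))} [HasExt.{w} X.left.Modules]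
  (ι : X.left ⟶ X.left) (hι : ι ≫ ι = 𝟙 X.left) {F : X.left.Modules}
  (lam : F ≅ (Scheme.Modules.pushforward ι).obj F)

/-- **The action of the involution `ι` on `Extⁿ(F, F)` induced by a linearisation `lam : F ≅ ι_* F`**:
`x ↦ lam⁻¹ ∘ ι_*(x) ∘ lam`, i.e. `F →[lam] ι_*F →[ι_* x] ι_*F⟦n⟧ →[lam⁻¹] F⟦n⟧` — `ι_*` is exact
(`ι` is an isomorphism), so it acts on Yoneda extensions (Mathlib `Ext.mapExactFunctor`), and `lam`, `lam⁻¹`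
act by composition (`Ext.mk₀`, `Ext.comp`). This is the action whose invariants `Ext²(E,E)^G` the equivariant
semiregularity theory uses (Perry 2026 §6, Thm. 6.3; Markman 2025 Lemma 8.3.4).
[cite: Perry2026Semiregularity, Thm. 6.3] -/
def extInvolutionAct (n : ℕ) (x : Ext.{w} F F n) : Ext.{w} F F n :=
  haveI := isIso_of_comp_self_eq_id ι hι
  (Ext.mk₀ lam.hom).comp
    ((x.mapExactFunctor (Scheme.Modules.pushforward ι)).comp (Ext.mk₀ lam.inv) (add_zero n))
    (zero_add n)

/-- **The `ι`-invariant part `Extⁿ(F, F)^{⟨ι⟩}`**: the `S`-submodule of `Extⁿ(F, F)` spanned by the classes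
fixed by `extInvolutionAct` (it IS the fixed set, the action being `S`-linear; the span spelling avoids proving
linearity here). [cite: Perry2026Semiregularity, Thm. 6.3] -/
def extInvariants (n : ℕ) : Submodule S (Ext.{w} F F n) :=
  Submodule.span S {x | extInvolutionAct ι hι lam n x = x}

/-- A fixed class lies in the invariant part. [folklore] -/
theorem mem_extInvariants_of_act_eq {n : ℕ} {x : Ext.{w} F F n}
    (hx : extInvolutionAct ι hι lam n x = x) : x ∈ extInvariants ι hι lam n :=
  Submodule.subset_span hx

variable (hE : IsFiniteLocallyFree F)

/-- **Invariant `I`-semiregularity**: the part `(σ_q)_{q ∈ I}` of the Buchweitz–Flenner semiregularity map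
`σ = (Tr(· ∘ At(F)^q))_q : Ext²(F, F) → ⊕_q H^{q+2}(X, Ω^q)` (`sigmaHigher`) is injective ON THE
`ι`-INVARIANT PART of `Ext²(F, F)`: `σ_q(x) = 0` for all `q ∈ I` and `x` invariant force `x = 0`
("`ℰ₀` is `I`-semiregular if the part `σ_I` of the semiregularity map is injective", BF §5, restricted to
`Ext²(F,F)^G` as in the equivariant theorem, Perry Thm. 6.3). For `I = Set.univ` this is the hypothesis
of the `μ₂`-equivariant semiregularity statement. [cite: BuchweitzFlenner2003, §5 (I-semiregular)]
[cite: Perry2026Semiregularity, Thm. 6.3] -/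
def IsInvariantISemiregular (I : Set ℕ) : Prop :=
  ∀ x ∈ extInvariants ι hι lam 2, (∀ q ∈ I, sigmaHigher hE q x = 0) → x = 0

/-- Plain `I`-semiregularity implies invariant `I`-semiregularity (injectivity on all of `Ext²` is
injectivity on the invariant part). [cite: BuchweitzFlenner2003, §5 (I-semiregular)] -/
theorem IsISemiregular.isInvariantISemiregular {I : Set ℕ} (h : IsISemiregular.{w} hE I) :
    IsInvariantISemiregular ι hι lam hE I :=
  fun x _ hx => h x hx

/-- Invariant `I`-semiregularity is monotone in `I`. [cite: BuchweitzFlenner2003, §5 (I-semiregular)] -/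
theorem IsInvariantISemiregular.mono {I J : Set ℕ} (hIJ : I ⊆ J)
    (h : IsInvariantISemiregular ι hι lam hE I) : IsInvariantISemiregular ι hι lam hE J :=
  fun x hxinv hx => h x hxinv fun q hq => hx q (hIJ hq)

end ExtAction

/-! ### The `B`-twisted Chern character `exp(B) ∪ ch(E)` -/

section TwistedCh

/-- Degree bookkeeping for `Bⁱ ∪ ch_{k-i}(E) ∈ H^{2k}`: `2i + 2(k - i) = 2k` for `i ≤ k`. [folklore] -/
theorem two_mul_add_two_mul_sub {i k : ℕ} (h : i < k + 1) : 2 * i + 2 * (k - i) = 2 * k := by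
  omega

/-- **The `B`-twisted Chern character, degree `2k`**: `(exp(B) ∪ ch(E))_k = Σ_{i=0}^{k} (1/i!) Bⁱ ∪ ch_{k-i}(E)`
for a class `B ∈ H²(X(ℂ); ℂ)` (a "`B`-field", typically rational and algebraic) and an `𝒪_X`-module `E`, in the
Chern character theory `C` (Huybrechts–Stellari: `ch^B(E) = ch(E) · exp(B)`; Perry, Thm. 1.1: the class
"`w_0 = exp(B_0) · ch(E_0)`" that the semiregularity theorem keeps algebraic). For `B = 0` only the term
`i = 0` survives and this is `ch_k(E)`. [cite: HuybrechtsStellari2005, §1 (twisted Chern character)]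
[cite: Perry2026Semiregularity, Thm. 1.1] -/
def expTwistCh (C : ChernCharacterBetti) (X : SchemeOver ℂ) (B : complexBetti X 2) (E : X.left.Modules)
    (k : ℕ) : complexBetti X (2 * k) :=
  ∑ i : Fin (k + 1), ((Nat.factorial (i : ℕ) : ℕ) : ℂ)⁻¹ •
    cupProduct (two_mul_add_two_mul_sub i.2) (cupPowTwo B i) (C.ch X E (k - i))

end TwistedCh

/-! ### The motivating involution: `[-1]` of an abelian variety -/

section AbelianNegOne

variable {k : Type u} [Field k] (Y : AbelianVariety k)

/-- **The inversion `[-1]_Y`** on the underlying scheme of the abelian variety `Y`: the scheme morphism of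
`-(𝟙 Y)` in the preadditive category of abelian varieties (Mumford §4, the inverse `i : X → X`). [cite: MumfordAV1970, §4] -/
abbrev abelianNegOne : Y.X.left ⟶ Y.X.left :=
  AbelianVariety.Hom.toSchemeHom (-(𝟙 Y))

/-- **`[-1] ∘ [-1] = id`**: the inversion of an abelian variety is an involution of its underlying scheme
(`(-𝟙) ≫ (-𝟙) = 𝟙` in the preadditive category, then forget). [cite: MumfordAV1970, §4] -/
theorem abelianNegOne_comp_abelianNegOne : abelianNegOne Y ≫ abelianNegOne Y = 𝟙 Y.X.left := by
  have h : (-(𝟙 Y)) ≫ (-(𝟙 Y)) = 𝟙 Y := by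
    rw [Preadditive.neg_comp, Preadditive.comp_neg, neg_neg, Category.id_comp]
  exact congrArg AbelianVariety.Hom.toSchemeHom h

end AbelianNegOne

end Literature.AlgebraicGeometry.HodgeTheory

end
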